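import Literature.NumberTheory.EllipticCurves.IsogenyRationalPointsBaseChangeProofs
import Literature.NumberTheory.EllipticCurves.IsogenyQuadraticTwistProofs
import Literature.NumberTheory.EllipticCurves.SquareClassHeightRat
import Literature.NumberTheory.EllipticCurves.TwistFamilySelmerGroupCardInvarianceProofs
import Mathlib.NumberTheory.NumberField.Completion.InfinitePlace
import Mathlib.NumberTheory.NumberField.InfinitePlace.TotallyRealComplex
import Mathlib.RingTheory.TensorProduct.Basic
import HarnessLib

/-!
# Bhargava–Klagsbrun–Lemke Oliver–Shnidman 2019, §2: the Selmer ratio of a `3`-isogeny, the classes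
# `T_m(φ)`, and the rank theorems for quadratic twist families of elliptic curves (Thms. 2.4–2.7)

Cross-ladder literature-typing layer (cell `bsd-littype`, seat 08, gen 5; "typed ≠ proved ≠
endorsed"). Source: M. Bhargava, Z. Klagsbrun, R. J. Lemke Oliver, A. Shnidman, *`3`-isogeny Selmer
groups and ranks of abelian varieties in quadratic twist families over a number field*, Duke Math.
J. **168** (2019), no. 15, 2951–2989 = arXiv:1709.09790 (REFEREED). Held text: the LaTeXML chunks
`paper:arxiv-1709.09790` (`pNNNN` = chunk, `L` = line); its theorem numbering is the Duke numbering
(Burungale–Tian, Ann. of Math. 203 (2026), p. 7, cite the CM theorem below as "[1, Thm. 2.7]").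

## What the tree had, and the gap this file closes

The tree stated BKLOS only through two SPECIAL CASES — the `19a3` paragraph after Thm. 2.6
(`BhargavaKlagsbrunLemkeOliverShnidman2019.cremona19a3_rankZero_selmerRankOne_proportions`) and
Burungale–Tian's CM case over the CM field (`burungaleTian_thm35_selmerCorank_three_twists`); the
general statements (any number field `F`) were the typing gap BT-Q8 of `OPEN-QUESTIONS-08.md` ("the
local Selmer ratio `c_𝔭(φ) = #coker/#ker` of `φ` on `E(F_𝔭)` is missing"). It is definable from the
tree's action of an isogeny on `L`-rational points (`Isogeny.exists_pointHom_baseChange_eq`, Milne's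
`f(K_v)`), the twisted isogeny `φ_s` (`Isogeny.quadraticTwist`), square classes with the BKLOS
height and lower proportions (`SquareClass`, `squareClassHeight`, `SquareClassProportionGe`,
`TwistClassSatisfies`) and the completions at all places (`v.adicCompletion K`, `w.Completion`).

## Locators (verbatim quotes are in the declaration docstrings)

| source item (chunk:line of `paper:arxiv-1709.09790`) | declaration | grade |
|---|---|---|
| §2 p0004 L7–L9, "`c_𝔭(φ_s) := |A'_s(F_𝔭)/φ(A_s(F_𝔭))| / |A_s[φ](F_𝔭)|`" | `Isogeny.pointHomOver`, `Isogeny.localSelmerRatio` | FAITHFUL |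
| §2 p0004 L16–L17, "`c(φ_s) := ∏_{𝔭 ≤ ∞} c_𝔭(φ_s)`" (finite by Thm (integrality), p0004 L13) | `selmerRatio` | FAITHFUL (finiteness of the product = the source's integrality theorem, not restated) |
| §2 p0004 L55, "`t(φ_s) := ord_3 c(φ_s)`" | `logSelmerRatio` | FAITHFUL |
| §2 p0005 L10–L12, "`T_m(φ) := {s ∈ F^*/F^{*2} : |t(φ_s)| = m}`" | `IsInSelmerRatioClass φ m` | FAITHFUL (models with `a₁ = a₃ = 0`, the source's `s̃y² = f(x)` convention p0003 L3; "every representative", as `TwistClassSatisfies`) |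
| §2 p0004 L19–L21 (local conditions; "finitely many local conditions") | `squareClassMap`, `IsDefinedByFinitelyManyLocalConditions` | FAITHFUL |
| §2 p0004 L25–L31 (`avg_Σ`, `Σ(X) := {s ∈ Σ : H(s) < X}`), p0005 L14 ("the density of `T_m(φ)`") | `squareClassAverage`, `SquareClassAverageLe` (`limsup ≤ B` as "∀ ε > 0, eventually `≤ B + ε`"), `squareClassProportion`, `HasSquareClassDensity`, `twistMordellWeilRank` | FAITHFUL |
| Thm. 2.4, p0005 L1–L2 | `thm24_averageRank_le` | WEAKER only in taking `avg_Σ(…)` (the source's LIMIT, display p0004 L25) as a hypothesis `Tendsto … (𝓝 a)` instead of asserting that the limit exists |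
| Thm. 2.5, p0005 L16–L22 ("`3`-Selmer rank" = `dim_{𝔽₃} Sel_3`, §9.2 p0014 L43–L47) | `thm25_proportions` | FAITHFUL ("`μ(T_m)` denotes the density" ↦ hypothesis `HasSquareClassDensity`; rank `0` ↦ `mordellWeilRank = 0`; `3`-Selmer rank `1` ↦ `#Sel^{(3)} = 3`, the `19a3` fact's currency) |
| Thm. 2.6, p0005 L27–L34 | `thm26_positiveProportions` | FAITHFUL ("positive proportion" ↦ `∃ δ > 0`, lower proportion `≥ δ`; "`dim Sel₃(E_s) ≥ r₂`" ↦ `3^{r₂} ≤ #Sel^{(3)}(E_s)`) |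
| Thm. 2.7, p0006 L1–L2 (BT26 p. 7: "[1, Thm. 2.7]") | `thm27_cm_averageRank_le_one` | FAITHFUL; general `F` ("`End_F(E) ⊗ ℚ ≅ K'`" ↦ `ℚ ⊗_ℤ endRing ≃ₐ[ℚ] K'`; "`3` not inert" ↦ `3𝓞_{K'}` not prime, as the tree's BT binder) — closes BT-Q8 |
| §2 p0005 L40–L41 (the `19a3` deduction "half … in `T_0`, half in `T_1` … `25%` … `41.6%`") | `proportions_of_thm25_of_density_half` (PROVED, any curve) | — |

"Proportion at least `x`" is read as LOWER proportion along the BKLOS height (`SquareClassProportionGe`),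
the reading of every BKLOS / Burungale–Tian proportion statement already in the tree. All four facts
are REFEREED (Duke); no `_holds` is expected (geometry-of-numbers count of `Sel_φ`, Cassels' formula
and parity, §9–§11).

## Not typed here (reasons)

Thm. 2.1 (average SIZE of `Sel_φ(A_s)`): needs the `φ`-Selmer group `Sel_φ ⊆ H¹(F, A[φ])` of an
isogeny with its local Kummer conditions — no carrier in the tree (the tree's isogeny ranks
`selmerIsogenyRank`/`Isogeny.divRank` live inside `H¹(F, E[p^∞])`); Thms. 2.2/2.3 (abelian varieties
of any dimension): no abelian-variety twist vocabulary; §10 (local formulas for `c_𝔭`), §11–§12.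

## References

* [BhargavaKlagsbrunLemkeOliverShnidman2019] Duke Math. J. 168 (2019) 2951–2989 = arXiv:1709.09790,
  §2 "Results" (chunks p0004–p0006 of the held text), §9.1–9.2 (chunk p0014).
* [SilvermanAEC2009] J. H. Silverman, *The Arithmetic of Elliptic Curves*, 2nd ed., III.§4, VIII.§1,
  X.§4 (isogenies on rational points; Selmer groups).
* [BurungaleTian2026] Ann. of Math. 203 (2026), §3.2.2 (cites Thm. 2.7 as "[1, Thm. 2.7]").
-/

noncomputable section

open scoped Classical TensorProduct NumberField
open Filter Topology
open WeierstrassCurve IsDedekindDomain NumberField NumberField.InfinitePlace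

universe u v

/-! ## §1 The isogeny on `L`-rational points and the local Selmer ratio `c_𝔭(φ)` -/

namespace WeierstrassCurve.Isogeny

open Literature.NumberTheory.EllipticCurves

variable {K : Type u} [Field K] [CharZero K] {W W' : WeierstrassCurve K}

/-- **The isogeny on `L`-rational points, `φ_L : E(L) →+ E'(L)`**, for an isogeny `φ : E → E'` over
`K` and a `K`-field `L` (of characteristic `0`, hence perfect): the witness of the tree's
`Isogeny.exists_pointHom_baseChange_eq` (Galois descent of `φ_{L̄}`), pinned along the chosen
embedding `closureEmb L : K̄ → L̄`. For `L = F_𝔭` a completion this is the map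
"`φ : A_s(F_𝔭) → A'_s(F_𝔭)`" of the source (Milne's `f(K_v)`, *ADT* I.7). Deliberate dot-notation
extension of the tree's `WeierstrassCurve.Isogeny`.
[cite: BhargavaKlagsbrunLemkeOliverShnidman2019, §2 (chunk p0004 L7: the map φ on A_s(F_𝔭))]
[cite: SilvermanAEC2009, III.§4 with VIII.§1] -/
def pointHomOver (φ : Isogeny W W') (L : Type u) [Field L] [Algebra K L] :
    (W.baseChange L).toAffine.Point →+ (W'.baseChange L).toAffine.Point :=
  haveI : CharZero L := charZero_of_injective_algebraMap (algebraMap K L).injective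
  letI : Algebra (AlgebraicClosure K) (AlgebraicClosure L) :=
    (closureEmb (K := K) L).toRingHom.toAlgebra
  haveI : IsScalarTower K (AlgebraicClosure K) (AlgebraicClosure L) :=
    IsScalarTower.of_algebraMap_eq fun x ↦ ((closureEmb (K := K) L).commutes x).symm
  (φ.exists_pointHom_baseChange_eq L).choose

/-- The defining property of `φ_L`: read in `E'(L̄)`, `φ_L Q` is `φ_{L̄}` of `Q` (the tree's local
points map `Isogeny.localPointsMap`, i.e. `Isogeny.baseChange` along `closureEmb L`).
[cite: SilvermanAEC2009, III.§4 with VIII.§1] -/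
theorem baseChange_pointHomOver (φ : Isogeny W W') (L : Type u) [Field L] [Algebra K L]
    (Q : (W.baseChange L).toAffine.Point) :
    (Affine.Point.baseChange (W' := W') L (AlgebraicClosure L) (φ.pointHomOver L Q) :
        localPoints W' L) =
      φ.localPointsMap L (Affine.Point.baseChange (W' := W) L (AlgebraicClosure L) Q) := by
  haveI : CharZero L := charZero_of_injective_algebraMap (algebraMap K L).injective
  letI : Algebra (AlgebraicClosure K) (AlgebraicClosure L) :=
    (closureEmb (K := K) L).toRingHom.toAlgebra
  haveI : IsScalarTower K (AlgebraicClosure K) (AlgebraicClosure L) :=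
    IsScalarTower.of_algebraMap_eq fun x ↦ ((closureEmb (K := K) L).commutes x).symm
  exact (φ.exists_pointHom_baseChange_eq L).choose_spec Q

/-- `E(L)[φ] = ker φ_L` is finite (it embeds in `E[φ] ⊆ E(K̄)`). Silverman, *AEC*, III.4.9.
[cite: SilvermanAEC2009, III.4, Cor. 4.9] -/
theorem finite_ker_pointHomOver (φ : Isogeny W W') (L : Type u) [Field L] [Algebra K L] :
    ((φ.pointHomOver L).ker : Set (W.baseChange L).toAffine.Point).Finite := by
  haveI : CharZero L := charZero_of_injective_algebraMap (algebraMap K L).injective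
  letI : Algebra (AlgebraicClosure K) (AlgebraicClosure L) :=
    (closureEmb (K := K) L).toRingHom.toAlgebra
  haveI : IsScalarTower K (AlgebraicClosure K) (AlgebraicClosure L) :=
    IsScalarTower.of_algebraMap_eq fun x ↦ ((closureEmb (K := K) L).commutes x).symm
  exact φ.finite_ker_pointHom (φ.exists_pointHom_baseChange_eq L).choose_spec

/-- **The local `φ`-Selmer ratio `c(φ) = |E'(L)/φ(E(L))| / |E(L)[φ]|`** of an isogeny
`φ : E → E'` over `K` at a `K`-field `L` (source, §2: "the local `φ`-Selmer ratio
`c_𝔭(φ_s) := |A'_s(F_𝔭)/φ(A_s(F_𝔭))| / |A_s[φ](F_𝔭)|`", for `L = F_𝔭` a completion of the number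
field `F`, finite or infinite; §10 computes it over `ℝ`, `ℂ` and `p`-adic fields). Cardinalities as
`Nat.card` (both groups are finite over local fields). Deliberate dot-notation extension of the
tree's `WeierstrassCurve.Isogeny`.
[cite: BhargavaKlagsbrunLemkeOliverShnidman2019, §2 (chunk p0004 L7–L9, definition of c_𝔭(φ_s)) and §10 (chunk p0015 L3–L6)] -/
def localSelmerRatio (φ : Isogeny W W') (L : Type u) [Field L] [Algebra K L] : ℚ :=
  (Nat.card ((W'.baseChange L).toAffine.Point ⧸ (φ.pointHomOver L).range) : ℚ) /
    Nat.card (φ.pointHomOver L).ker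

end WeierstrassCurve.Isogeny

namespace Literature.NumberTheory.EllipticCurves

/-! ## §2 Square classes: proportions, densities, averages, local conditions -/

section SquareClasses

variable {K : Type u} [Field K]

/-- The square-class map `K^×/(K^×)² → L^×/(L^×)²` induced by a field homomorphism `f : K → L`
(squares go to squares); for `f : F → F_𝔭` this is the localisation `s ↦ s ∈ F_𝔭^*/F_𝔭^{*2}` of the
source's local conditions. [cite: BhargavaKlagsbrunLemkeOliverShnidman2019, §2 (chunk p0004 L19–L21, local conditions Σ_𝔭 ⊆ F_𝔭*/F_𝔭*²)] -/
def squareClassMap {L : Type v} [Field L] (f : K →+* L) : SquareClass K →* SquareClass L :=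
  QuotientGroup.map _ _ (Units.map (f : K →* L)) (by
    rintro _ ⟨u, rfl⟩
    exact ⟨Units.map (f : K →* L) u, by simp only [powMonoidHom_apply, map_pow]⟩)

/-- `squareClassMap f [s] = [f s]`. [cite: BhargavaKlagsbrunLemkeOliverShnidman2019, §2 (chunk p0004 L19–L21)] -/
theorem squareClassMap_mk {L : Type v} [Field L] (f : K →+* L) (s : Kˣ) :
    squareClassMap f (QuotientGroup.mk s) = QuotientGroup.mk (Units.map (f : K →* L) s) :=
  rfl

/-- **The rank of the twist `E_t(F)`, `t ∈ F^×/(F^×)²`** (source: "the average rank of `E_s(F)`"):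
the Mordell–Weil rank of `V.quadraticTwist s` for a representative `s` of `t`; independent of the
representative (`twistMordellWeilRank_mk`, from the tree's
`mordellWeilRank_quadraticTwist_eq_of_mk_eq`: `E^{(s u²)} ≅_F E^{(s)}`).
[cite: BhargavaKlagsbrunLemkeOliverShnidman2019, Thm. 2.4 (chunk p0005 L1–L2, "the average rank of E_s(F)")] -/
def twistMordellWeilRank (V : WeierstrassCurve K) (t : SquareClass K) : ℕ :=
  (V.quadraticTwist ((Quotient.out t : Kˣ) : K)).mordellWeilRank

/-- `twistMordellWeilRank V [s] = rank E^{(s)}(F)` for every representative `s`.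
[cite: BhargavaKlagsbrunLemkeOliverShnidman2019, §1 (chunk p0003 L3: A_s depends on the squareclass s)] -/
theorem twistMordellWeilRank_mk (V : WeierstrassCurve K) (s : Kˣ) :
    twistMordellWeilRank V (QuotientGroup.mk s) = (V.quadraticTwist (s : K)).mordellWeilRank :=
  mordellWeilRank_quadraticTwist_eq_of_mk_eq V (QuotientGroup.out_eq' _)

variable [NumberField K]

/-- **"`Σ ⊂ F^*/F^{*2}` is defined by finitely many local conditions"** (source, §2): there are a
finite set `P` of finite places, local conditions `Λ_v ⊆ F_v^*/F_v^{*2}` at the finite places and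
`Λ_w ⊆ F_w^*/F_w^{*2}` at the (finitely many) infinite places, such that `Σ` is the set of classes
whose localisations lie in `Λ_v` for `v ∈ P` and in `Λ_w` for every infinite `w` (no condition at the
finite places outside `P`: "`Σ_𝔭 = F_𝔭^*/F_𝔭^{*2}` for all but finitely many `𝔭`").
[cite: BhargavaKlagsbrunLemkeOliverShnidman2019, §2 (chunk p0004 L19–L21)] -/
def IsDefinedByFinitelyManyLocalConditions (S : Set (SquareClass K)) : Prop :=
  ∃ (P : Finset (HeightOneSpectrum (𝓞 K)))
    (Λf : (v : HeightOneSpectrum (𝓞 K)) → Set (SquareClass (v.adicCompletion K)))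
    (Λi : (w : InfinitePlace K) → Set (SquareClass w.Completion)),
    S = {t | (∀ v ∈ P, squareClassMap (algebraMap K (v.adicCompletion K)) t ∈ Λf v) ∧
      ∀ w : InfinitePlace K, squareClassMap (algebraMap K w.Completion) t ∈ Λi w}

/-- The proportion `#{t : H(t) < X ∧ P(t)} / #{t : H(t) < X}` of square classes of height `< X`
with property `P` — the sequence whose `liminf` the tree's `SquareClassProportionGe` bounds below
(`squareClassProportionGe_iff_liminf`) and whose limit, when it exists, is the source's density
"`μ(T_m(φ))` […] the density of `T_m(φ)` within `F^*/F^{*2}`".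
[cite: BhargavaKlagsbrunLemkeOliverShnidman2019, §2 (chunk p0004 L29–L31: Σ(X) = {s ∈ Σ : H(s) < X}; chunk p0005 L14: the density μ(T_m(φ)))] -/
def squareClassProportion (P : SquareClass K → Prop) (X : ℕ) : ℝ :=
  (Nat.card {t : SquareClass K | squareClassHeight t < X ∧ P t} : ℝ) /
    Nat.card {t : SquareClass K | squareClassHeight t < X}

/-- The tree's `SquareClassProportionGe P δ` is `δ ≤ liminf_X squareClassProportion P X`
(definitional). [cite: BhargavaKlagsbrunLemkeOliverShnidman2019, §2 (chunk p0004 L29–L31)] -/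
theorem squareClassProportionGe_iff_liminf (P : SquareClass K → Prop) (δ : ℝ) :
    SquareClassProportionGe P δ ↔ δ ≤ liminf (squareClassProportion P) atTop :=
  Iff.rfl

/-- **"`μ(T)` denotes the density of `T` within `F^*/F^{*2}`"** (source, §2, for `T = T_m(φ)`): the
proportions of `T` among the square classes of height `< X` CONVERGE to `μ` as `X → ∞` (classes
ordered by the height `H`, the source's only ordering, p0004 L21–L31).
[cite: BhargavaKlagsbrunLemkeOliverShnidman2019, §2 (chunk p0005 L14, "let μ(T_m(φ)) denote the density of T_m(φ) within F*/F*²")] -/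
def HasSquareClassDensity (P : SquareClass K → Prop) (μ : ℝ) : Prop :=
  Tendsto (squareClassProportion P) atTop (𝓝 μ)

/-- A set of square classes with density `μ` has lower proportion `≥ δ` for every `δ ≤ μ`
(`liminf` of a convergent sequence is its limit). [cite: BhargavaKlagsbrunLemkeOliverShnidman2019, §2 (chunk p0005 L14)] -/
theorem HasSquareClassDensity.squareClassProportionGe {P : SquareClass K → Prop} {μ δ : ℝ}
    (h : HasSquareClassDensity P μ) (hδ : δ ≤ μ) : SquareClassProportionGe P δ := by
  rw [squareClassProportionGe_iff_liminf, Tendsto.liminf_eq h]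
  exact hδ

/-- The average `(1/|Σ(X)|) ∑_{s ∈ Σ(X)} f(s)` of a real function over the classes of `Σ` of height
`< X` (`Σ(X) := {s ∈ Σ : H(s) < X}`, a finite set; `finsum`/`Nat.card`).
[cite: BhargavaKlagsbrunLemkeOliverShnidman2019, §2 (chunk p0004 L25–L31, avg_Σ and Σ(X))] -/
def squareClassAverage (S : Set (SquareClass K)) (f : SquareClass K → ℝ) (X : ℕ) : ℝ :=
  (∑ᶠ t ∈ {t : SquareClass K | t ∈ S ∧ squareClassHeight t < X}, f t) /
    Nat.card {t : SquareClass K | t ∈ S ∧ squareClassHeight t < X}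

/-- **"The average of `f` over `s ∈ Σ` (ordered by the height of `s`) is at most `B`"** (source,
Thm. 2.4: "the average rank of `E_s(F)`, `s ∈ Σ`, is at most …"; Thm. 2.7: "the average rank of
`E_s(F)` for `s ∈ F^*/F^{*2}` is at most `1`"): `limsup_X (1/|Σ(X)|) ∑_{s ∈ Σ(X)} f(s) ≤ B`, written
as "for every `ε > 0`, eventually the finite averages are `≤ B + ε`" (no junk `limsup` values).
[cite: BhargavaKlagsbrunLemkeOliverShnidman2019, Thm. 2.4 (chunk p0005 L1–L2) and Thm. 2.7 (chunk p0006 L1–L2)] -/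
def SquareClassAverageLe (S : Set (SquareClass K)) (f : SquareClass K → ℝ) (B : ℝ) : Prop :=
  ∀ ε : ℝ, 0 < ε → ∀ᶠ X : ℕ in atTop, squareClassAverage S f X ≤ B + ε

end SquareClasses

/-! ## §3 The global Selmer ratio `c(φ)`, `t(φ) = ord₃ c(φ)`, and the classes `T_m(φ)` -/

namespace BhargavaKlagsbrunLemkeOliverShnidman2019

variable {K : Type u} [Field K] [NumberField K] {V V' : WeierstrassCurve K}

/-- **The global Selmer ratio `c(φ) = ∏_{𝔭 ≤ ∞} c_𝔭(φ)`** of an isogeny `φ : E → E'` over a number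
field `F` (source, §2: "Recall the definition of the global Selmer ratio:
`c(φ_s) := ∏_{𝔭 ≤ ∞} c_𝔭(φ_s)`"): the product of the local Selmer ratios
(`Isogeny.localSelmerRatio`) over the finite places (`finprod`; by the source's Theorem
(integrality), p0004 L13, `c_𝔭 = 1` for every finite `𝔭 ∤ 3𝔣_E`, so the product is finite) times
the product over the infinite places.
[cite: BhargavaKlagsbrunLemkeOliverShnidman2019, §2 (chunk p0004 L16–L17, c(φ_s); L13, finiteness)] -/
def selmerRatio (φ : Isogeny V V') : ℚ :=
  (∏ᶠ v : HeightOneSpectrum (𝓞 K), φ.localSelmerRatio (v.adicCompletion K)) *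
    ∏ w : InfinitePlace K, φ.localSelmerRatio w.Completion

/-- **The logarithmic Selmer ratio `t(φ) := ord₃ c(φ)`** (source, §2: "the global Selmer ratio
`c(φ_s)` lies in `3^ℤ`, and we take `t(φ_s) := ord_3 c(φ_s)`"; `padicValRat 3`).
[cite: BhargavaKlagsbrunLemkeOliverShnidman2019, §2 (chunk p0004 L55)] -/
def logSelmerRatio (φ : Isogeny V V') : ℤ :=
  padicValRat 3 (selmerRatio φ)

/-- **"`t ∈ T_m(φ)`"** (source, §2: "`T_m(φ) := {s ∈ F^*/F^{*2} : |t(φ_s)| = m}`", where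
`φ_s : E_s → E'_s` is the twisted isogeny, "For each `s ∈ F^*/F^{*2}`, there is also an isogeny
`φ_s : A_s → A'_s`", p0004 L3), for `φ : V → V'` between models with `a₁ = a₃ = 0` (the source's
twisting convention "`A_s` has model `s̃ y² = f(x)`"; the tree's `Isogeny.quadraticTwist`): every
representative `s` of the class `t` has `|t(φ_s)| = m` ("every representative", as in the tree's
`TwistClassSatisfies`; the twisted pair is a `K`-isomorphism class).
[cite: BhargavaKlagsbrunLemkeOliverShnidman2019, §2 (chunk p0005 L10–L12, T_m(φ); chunk p0004 L3, φ_s)] -/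
def IsInSelmerRatioClass [V.IsCharNeTwoNF] [V'.IsCharNeTwoNF] (φ : Isogeny V V') (m : ℕ)
    (t : SquareClass K) : Prop :=
  ∀ s : Kˣ, (QuotientGroup.mk s : SquareClass K) = t →
    (logSelmerRatio (φ.quadraticTwist (Units.ne_zero s))).natAbs = m

/-- A class lies in at most one `T_m(φ)` (every class has a representative).
[cite: BhargavaKlagsbrunLemkeOliverShnidman2019, §2 (chunk p0005 L10–L12)] -/
theorem isInSelmerRatioClass_unique [V.IsCharNeTwoNF] [V'.IsCharNeTwoNF] (φ : Isogeny V V')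
    {m m' : ℕ} {t : SquareClass K} (h : IsInSelmerRatioClass φ m t)
    (h' : IsInSelmerRatioClass φ m' t) : m = m' := by
  obtain ⟨s, rfl⟩ := QuotientGroup.mk_surjective t
  rw [← h s rfl, ← h' s rfl]

/-- **The summand `|t(φ_s)| + 3^{-|t(φ_s)|}` of Theorem 2.4**, as a real function of the class of
`s` (evaluated at a representative; the source's bound is
`avg_Σ(|t(φ_s)| + 3^{-|t(φ_s)|})`).
[cite: BhargavaKlagsbrunLemkeOliverShnidman2019, Thm. 2.4 (chunk p0005 L1–L2)] -/
def rankBoundSummand [V.IsCharNeTwoNF] [V'.IsCharNeTwoNF] (φ : Isogeny V V')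
    (t : SquareClass K) : ℝ :=
  ((logSelmerRatio (φ.quadraticTwist (Units.ne_zero (Quotient.out t : Kˣ)))).natAbs : ℝ) +
    (3 : ℝ)⁻¹ ^ (logSelmerRatio (φ.quadraticTwist (Units.ne_zero (Quotient.out t : Kˣ)))).natAbs

/-! ## §4 The printed theorems for elliptic curves (named facts, REFEREED) -/

/-- **Bhargava–Klagsbrun–Lemke Oliver–Shnidman 2019, Theorem 2.4** (Duke Math. J. 168): "Suppose
`E/F` is an elliptic curve admitting a `3`-isogeny and let `Σ ⊂ F^*/F^{*2}` be defined by finitely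
many local conditions. Then the average rank of `E_s(F)`, `s ∈ Σ`, is at most
`avg_Σ(|t(φ_s)| + 3^{-|t(φ_s)|})`." Transcription: `F = K` a number field; `E → E'` =
`φ : Isogeny V V'` of degree `3` (`Isogeny.degree = #ker`, the degree in characteristic `0`) between
elliptic models with `a₁ = a₃ = 0` (twisting convention of the source); `Σ = S` with
`IsDefinedByFinitelyManyLocalConditions S`; `avg_Σ(·)` is the source's limit
`lim_X (1/|Σ(X)|) ∑_{s ∈ Σ(X)} (…)` (p0004 L25), taken as the hypothesis "the finite averages of
`rankBoundSummand φ` over `Σ(X)` tend to `a`" — the statement does not assert that this limit exists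
(the source evaluates it as a finite Euler product; WEAKER only in this respect); conclusion
`SquareClassAverageLe S (rank E_t(F)) a`. REFEREED; no `_holds` expected (geometry-of-numbers count
of `Sel_φ`, Cassels' formula). [cite: BhargavaKlagsbrunLemkeOliverShnidman2019, Thm. 2.4 (chunk p0005 L1–L2) with §2 (chunk p0004 L19–L31, L55) and §9.1 (chunk p0014 L30–L41)] -/
def thm24_averageRank_le : Prop :=
  ∀ (K : Type) [Field K] [NumberField K] (V V' : WeierstrassCurve K) [V.IsElliptic] [V'.IsElliptic]
    [V.IsCharNeTwoNF] [V'.IsCharNeTwoNF] (φ : Isogeny V V'), φ.degree = 3 →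
    ∀ (S : Set (SquareClass K)), IsDefinedByFinitelyManyLocalConditions S →
    ∀ (a : ℝ), Tendsto (squareClassAverage S (rankBoundSummand φ)) atTop (𝓝 a) →
      SquareClassAverageLe S (fun t ↦ (twistMordellWeilRank V t : ℝ)) a

/-- **Bhargava–Klagsbrun–Lemke Oliver–Shnidman 2019, Theorem 2.5** (Duke Math. J. 168): "Let `E` be
an elliptic curve over `F` admitting a `3`-isogeny `φ : E → E'`. Then (a) The proportion of twists
`E_s` having rank `0` is at least `½ μ(T_0(φ))`; and (b) The proportion of twists `E_s` having
`3`-Selmer rank `1` is at least `⅚ μ(T_1(φ))`", where "`μ(T_m(φ))` denote[s] the density of `T_m(φ)`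
within `F^*/F^{*2}`". Transcription: as in `thm24_averageRank_le`; "`μ(T_m(φ))` denotes the density"
↦ hypothesis `HasSquareClassDensity (IsInSelmerRatioClass φ m) μ_m`; "the proportion of twists … is
at least `x`" ↦ `SquareClassProportionGe (TwistClassSatisfies V …) x` (lower proportion along the
height `H`, the tree's reading of every BKLOS/Burungale–Tian proportion statement); "rank `0`" ↦
`mordellWeilRank = 0`; "`3`-Selmer rank `1`" (`dim_{𝔽₃} Sel_3(E_s) = 1`, §9.2) ↦
`#Sel^{(3)}(E_s/F) = 3` (`Nat.card (E.selmerGroup 3) = 3`, the currency of the tree's `19a3` fact).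
The closing sentence of the theorem (rank `1` for `⅚ μ₁(φ)` "if we assume … that
`dim_{𝔽₃} Ш(E_s)[3]` is even for all `s`") is a conditional remark and not part of this binder
(the tree's `TwistFamilySelmerCorankParityProofs` proves the corank form of that bridge). REFEREED;
no `_holds` expected. [cite: BhargavaKlagsbrunLemkeOliverShnidman2019, Thm. 2.5 (chunk p0005 L16–L22) with §2 (chunk p0005 L10–L14) and §9.2 (chunk p0014 L43–L47)] -/
def thm25_proportions : Prop :=
  ∀ (K : Type) [Field K] [NumberField K] (V V' : WeierstrassCurve K) [V.IsElliptic] [V'.IsElliptic]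
    [V.IsCharNeTwoNF] [V'.IsCharNeTwoNF] (φ : Isogeny V V'), φ.degree = 3 →
    (∀ μ₀ : ℝ, HasSquareClassDensity (IsInSelmerRatioClass φ 0) μ₀ →
        SquareClassProportionGe
          (TwistClassSatisfies V fun E : WeierstrassCurve K ↦ E.mordellWeilRank = 0) (μ₀ / 2)) ∧
    (∀ μ₁ : ℝ, HasSquareClassDensity (IsInSelmerRatioClass φ 1) μ₁ →
        SquareClassProportionGe
          (TwistClassSatisfies V fun E : WeierstrassCurve K ↦ Nat.card (E.selmerGroup 3) = 3)
          (5 / 6 * μ₁))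

/-- **Bhargava–Klagsbrun–Lemke Oliver–Shnidman 2019, Theorem 2.6** (Duke Math. J. 168): "Let `E` be
an elliptic curve over `F` and suppose `E` admits a `3`-isogeny. (a) If `F` is totally real, then a
positive proportion of `E_s` have rank `0` and a positive proportion of `E_s` have `3`-Selmer rank
`1`. (b) If `F` has at most one complex place and at least one real place, then a positive proportion
of `E_s` have `3`-Selmer rank `1`. (c) If `F` is imaginary quadratic, then a positive proportion of
`E_s` have rank `0` or `1`. Furthermore, if `F` has `r₂` complex places, then there exists an elliptic
curve `E` over `F` admitting a `3`-isogeny and for which `dim_{𝔽₃} Sel_3(E_s) ≥ r₂` for all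
`s ∈ F^*/F^{*2}`." Transcription: "admits a `3`-isogeny" ↦ `φ : Isogeny V V'`, `φ.degree = 3`,
`V, V'` elliptic (any models: the twists `E_s` enter only through `TwistClassSatisfies V`); "positive
proportion" ↦ `∃ δ > 0` with lower proportion `≥ δ`; totally real ↦ `IsTotallyReal K`; "at most one
complex place and at least one real place" ↦ `nrComplexPlaces K ≤ 1 ∧ 1 ≤ nrRealPlaces K`;
imaginary quadratic ↦ the tree's `IsImaginaryQuadratic K`; "rank `0` or `1`" ↦
`mordellWeilRank ≤ 1`; "`3`-Selmer rank `1`" ↦ `#Sel^{(3)} = 3`; "`dim_{𝔽₃} Sel_3(E_s) ≥ r₂`" ↦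
`3^{r₂} ≤ #Sel^{(3)}(E_s/F)` (`r₂ = nrComplexPlaces K`). REFEREED; no `_holds` expected.
[cite: BhargavaKlagsbrunLemkeOliverShnidman2019, Thm. 2.6 (chunk p0005 L27–L34) with §11 "Proof of Theorem (totreal)" (chunk p0017 L5 ff.)] -/
def thm26_positiveProportions : Prop :=
  ∀ (K : Type) [Field K] [NumberField K],
    (∀ (V V' : WeierstrassCurve K) [V.IsElliptic] [V'.IsElliptic] (φ : Isogeny V V'),
      φ.degree = 3 →
      (IsTotallyReal K →
        (∃ δ : ℝ, 0 < δ ∧ SquareClassProportionGe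
          (TwistClassSatisfies V fun E : WeierstrassCurve K ↦ E.mordellWeilRank = 0) δ) ∧
        (∃ δ : ℝ, 0 < δ ∧ SquareClassProportionGe
          (TwistClassSatisfies V fun E : WeierstrassCurve K ↦ Nat.card (E.selmerGroup 3) = 3) δ)) ∧
      (nrComplexPlaces K ≤ 1 → 1 ≤ nrRealPlaces K →
        ∃ δ : ℝ, 0 < δ ∧ SquareClassProportionGe
          (TwistClassSatisfies V fun E : WeierstrassCurve K ↦ Nat.card (E.selmerGroup 3) = 3) δ) ∧
      (IsImaginaryQuadratic K →
        ∃ δ : ℝ, 0 < δ ∧ SquareClassProportionGe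
          (TwistClassSatisfies V fun E : WeierstrassCurve K ↦ E.mordellWeilRank ≤ 1) δ)) ∧
    (∃ (V V' : WeierstrassCurve K) (φ : Isogeny V V'), V.IsElliptic ∧ V'.IsElliptic ∧
      φ.degree = 3 ∧
      ∀ s : Kˣ, 3 ^ nrComplexPlaces K ≤ Nat.card ((V.quadraticTwist (s : K)).selmerGroup 3))

/-- **Bhargava–Klagsbrun–Lemke Oliver–Shnidman 2019, Theorem 2.7** (Duke Math. J. 168; the theorem
Burungale–Tian 2026 cite as "[1, Thm. 2.7]" for their Thm. 3.5): "Suppose that `E` is an elliptic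
curve over a number field `F` such that `End_F(E) ⊗ ℚ` is an imaginary quadratic field in which `3`
is not inert. Then the average rank of `E_s(F)` for `s ∈ F^*/F^{*2}` is at most `1`, and at least
`50%` of twists `E_s` have rank `0`." Transcription: `End_F(E)` = the tree's
`WeierstrassCurve.endRing` (the `Γ_F`-equivariant algebraic endomorphisms of `E(F̄)`);
"`End_F(E) ⊗ ℚ` is an imaginary quadratic field in which `3` is not inert" ↦ there is an imaginary
quadratic number field `K'` (tree: `IsImaginaryQuadratic`) with `3𝓞_{K'}` not a prime ideal and a
`ℚ`-algebra isomorphism `ℚ ⊗_ℤ End_F(E) ≃ K'`; "average rank … at most `1`" ↦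
`SquareClassAverageLe univ (rank E_t(F)) 1`; "at least `50%` … rank `0`" ↦ lower proportion
`≥ 1/2` of `mordellWeilRank = 0`. General `F` (the tree's `burungaleTian_thm35_selmerCorank_three_twists`
is Burungale–Tian's Selmer-corank form of the case `F =` the CM field). REFEREED; no `_holds`
expected. [cite: BhargavaKlagsbrunLemkeOliverShnidman2019, Thm. 2.7 (chunk p0006 L1–L2) with §2 (chunk p0005 L43–L46) and §11 "Proof of Theorem (cm)" (chunk p0017 L58–L60: F*/F*² = T_0(φ))] [cite: BurungaleTian2026, §3.2.2 (p. 7, "[1, Thm. 2.7]")] -/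
def thm27_cm_averageRank_le_one : Prop :=
  ∀ (K : Type) [Field K] [NumberField K] (V : WeierstrassCurve K) [V.IsElliptic],
    (∃ (K' : Type) (_ : Field K') (_ : NumberField K'), IsImaginaryQuadratic K' ∧
        ¬ (Ideal.span ({3} : Set (𝓞 K'))).IsPrime ∧ Nonempty (ℚ ⊗[ℤ] V.endRing ≃ₐ[ℚ] K')) →
    SquareClassAverageLe Set.univ (fun t ↦ (twistMordellWeilRank V t : ℝ)) 1 ∧
      SquareClassProportionGe
        (TwistClassSatisfies V fun E : WeierstrassCurve K ↦ E.mordellWeilRank = 0) (1 / 2)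

/-! ## §5 Proved read-outs -/

/-- **The printed deduction for a curve all of whose twist classes lie in `T_0(φ) ∪ T_1(φ)` with
densities `½`, `½`** (source, §2, the `19a3` paragraph, p0005 L40–L41: "half of the squareclasses lie
in `T_0(φ)` and half lie in `T_1(φ)`. Thus […] by Theorem 2.5, at least `25%` of twists `E_s` have
rank `0` and at least `41.6%` have `3`-Selmer rank `1`"): Theorem 2.5 gives, for ANY `3`-isogeny
`φ : E → E'` over any number field with `μ(T_0(φ)) = μ(T_1(φ)) = ½`, the two clauses of the tree's
`cremona19a3_rankZero_selmerRankOne_proportions` (`≥ ¼` rank `0`, `≥ 5/12` with `#Sel^{(3)} = 3`) —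
that fact is the special case `E = 19a3` modulo the two printed densities.
[cite: BhargavaKlagsbrunLemkeOliverShnidman2019, §2 (chunk p0005 L40–L41) with Thm. 2.5 (chunk p0005 L16–L22)] -/
theorem proportions_of_thm25_of_density_half (h : thm25_proportions) {K : Type} [Field K]
    [NumberField K] {V V' : WeierstrassCurve K} [V.IsElliptic] [V'.IsElliptic] [V.IsCharNeTwoNF]
    [V'.IsCharNeTwoNF] (φ : Isogeny V V') (hφ : φ.degree = 3)
    (h₀ : HasSquareClassDensity (IsInSelmerRatioClass φ 0) (1 / 2))
    (h₁ : HasSquareClassDensity (IsInSelmerRatioClass φ 1) (1 / 2)) :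
    SquareClassProportionGe
        (TwistClassSatisfies V fun E : WeierstrassCurve K ↦ E.mordellWeilRank = 0) (1 / 4) ∧
      SquareClassProportionGe
        (TwistClassSatisfies V fun E : WeierstrassCurve K ↦ Nat.card (E.selmerGroup 3) = 3)
        (5 / 12) := by
  obtain ⟨ha, hb⟩ := h K V V' φ hφ
  refine ⟨?_, ?_⟩
  · have e : (1 / 2 : ℝ) / 2 = 1 / 4 := by norm_num
    exact e ▸ ha (1 / 2) h₀
  · have e : (5 / 6 : ℝ) * (1 / 2) = 5 / 12 := by norm_num
    exact e ▸ hb (1 / 2) h₁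

/-- Theorem 2.7, the rank-`0` clause on its own: under the CM hypothesis, at least `50%` of the
twists `E_t`, `t ∈ F^×/(F^×)²`, have Mordell–Weil rank `0`.
[cite: BhargavaKlagsbrunLemkeOliverShnidman2019, Thm. 2.7 (chunk p0006 L1–L2)] -/
theorem thm27_rank_zero_half (h : thm27_cm_averageRank_le_one) {K : Type} [Field K] [NumberField K]
    (V : WeierstrassCurve K) [V.IsElliptic] {K' : Type} [Field K'] [NumberField K']
    (hK' : IsImaginaryQuadratic K') (h3 : ¬ (Ideal.span ({3} : Set (𝓞 K'))).IsPrime)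
    (e : ℚ ⊗[ℤ] V.endRing ≃ₐ[ℚ] K') :
    SquareClassProportionGe
      (TwistClassSatisfies V fun E : WeierstrassCurve K ↦ E.mordellWeilRank = 0) (1 / 2) := by
  have hyp : ∃ (K' : Type) (_ : Field K') (_ : NumberField K'), IsImaginaryQuadratic K' ∧
      ¬ (Ideal.span ({3} : Set (𝓞 K'))).IsPrime ∧ Nonempty (ℚ ⊗[ℤ] V.endRing ≃ₐ[ℚ] K') :=
    ⟨K', inferInstance, inferInstance, hK', h3, ⟨e⟩⟩
  exact (h K V hyp).2

/-- Theorem 2.5 (a) combined with a density: if `T_0(φ)` has density `μ₀`, every `δ ≤ μ₀/2` is a lower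
proportion of rank-`0` twists (monotonicity in `δ`).
[cite: BhargavaKlagsbrunLemkeOliverShnidman2019, Thm. 2.5 (a) (chunk p0005 L16–L19)] -/
theorem squareClassProportionGe_rank_zero_of_thm25 (h : thm25_proportions) {K : Type} [Field K]
    [NumberField K] {V V' : WeierstrassCurve K} [V.IsElliptic] [V'.IsElliptic] [V.IsCharNeTwoNF]
    [V'.IsCharNeTwoNF] (φ : Isogeny V V') (hφ : φ.degree = 3) {μ₀ δ : ℝ}
    (h₀ : HasSquareClassDensity (IsInSelmerRatioClass φ 0) μ₀) (hδ : δ ≤ μ₀ / 2) :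
    SquareClassProportionGe
      (TwistClassSatisfies V fun E : WeierstrassCurve K ↦ E.mordellWeilRank = 0) δ :=
  le_trans hδ ((h K V V' φ hφ).1 μ₀ h₀)

end BhargavaKlagsbrunLemkeOliverShnidman2019

end Literature.NumberTheory.EllipticCurves
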